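import Literature.Topology.FourManifolds.ComplexProjectiveSpace
import HarnessLib

/-!
# The projective line `ℂℙ¹ ⊂ ℂℙ²` and the realified clutching matrices (auxiliary definitions)

Topic `Literature/Topology/FourManifolds`, companion of `ComplexProjectiveSpace.lean`. Auxiliary
DEFINITIONS (with their elementary API, everything proved, no named facts) for the proof that
`ℂℙ²` is not spin (`SPC4SpinCP2Proofs.lean`, discharging
`Literature.Topology.FourManifolds.not_isSpin_complexProjectivePlane`): the non-triviality of
`Tℂℙ²|_{ℂℙ¹} ⊕ ℝ` is read off its clutching function along the equator of `ℂℙ¹ = S²`, which in the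
two affine charts of `ℂℙ²` is the realification of the complex Jacobian `diag(-1/w², 1/w)` of the
chart change `(a, b) ↦ (1/a, b/a)` at the points `(w, 0)` of the line (Milnor–Stasheff,
*Characteristic Classes*, §14: `Tℂℙⁿ ⊕ ℂ ≅ (n+1) γ̄¹`, here `Tℂℙ²|_{ℂℙ¹} ≅ Tℂℙ¹ ⊕ ν = 𝒪(2) ⊕ 𝒪(1)`;
Kirby, *The Topology of 4-Manifolds*, Ch. II §1: the normal bundle of `ℂℙ¹ ⊂ ℂℙ²` is the Hopf
bundle).

* `ComplexProjectiveSpace.instChartedSpaceOne` — `ℂℙ¹` charted on the literal model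
  `EuclideanSpace ℝ (Fin 2)` (re-export of the instance at `Fin (2 * 1)`), so that `ℂℙ¹` is a
  "closed surface" in the sense of `Literature.Topology.FourManifolds.IsSpin`.
* `ComplexProjectiveSpace.lineIncl`, `lineInclCM` — the line `[v₀ : v₁] ↦ [v₀ : v₁ : 0]`
  (`Projectivization.map` of the linear inclusion `ℂ² → ℂ³`), continuous; the parametrisations
  `linePt₀ w = [1 : w]`, `linePt₁ u = [u : 1]` of its two affine pieces, with
  `[1 : w] = [w̄ : 1]` on the unit circle and the values of the affine chart `0` of `ℂℙ²` along
  the line.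
* `ComplexProjectiveSpace.realCoordinates_two_apply`, `…_symm_apply` — the realification
  `ℂ² ≅ ℝ⁴` of `ComplexProjectiveSpace.lean` in coordinates: `(Re z₀, Re z₁, Im z₀, Im z₁)`.
* `coord5 : ℝ⁴ × ℝ →ₗ ℝ⁵`, `frameMat` — coordinates of `Tₓℂℙ² ⊕ ℝ` read in a chart, and the
  `5 × 5` matrix of a `5`-frame (invertible iff the frame is linearly independent).
* `cmat a b` — the real `5 × 5` matrix of `(z₀, z₁, t) ↦ (a z₀, b z₁, t)`, multiplicative in
  `(a, b)`; `cmat (c - is) 1` is the stabilised coordinate rotation; `cmat_mulVec_coord5`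
  identifies it with the complex-diagonal map through `realCoordinates 2`.
* `pmat w` — an explicit invertible `5 × 5` matrix depending polynomially on `w ∈ ℂ` with
  `pmat w = cmat (-w) w` for `|w| = 1`: right multiplication by the quaternion
  `w + (1 - |w|²) j` on `ℍ ≅ ℂ²` (realified, one sign flipped, stabilised), i.e. the classical
  null-homotopy of the loop `diag(-w, w)` of even total degree in `GL₄(ℝ)`
  (`pmat wᵀ pmat w = (|w|² + (1 - |w|²)²) · 1 ⊕ 1`).

All matrices are indexed by `Fin 5` in the coordinate order `(Re z₀, Re z₁, Im z₀, Im z₁, t)`;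
the model space is written `EuclideanSpace ℝ (Fin (2 * 2))`, the key under which the charts of
`ComplexProjectiveSpace 2` are registered (the statements about `ComplexProjectivePlane` at the
literal `Fin 4` are definitionally equal and are transported by `exact` in the proof file).

## References

* J. Milnor, J. Stasheff, *Characteristic Classes*, Princeton (1974), §14. [MilnorStasheffAMS76]
* R. Kirby, *The Topology of 4-Manifolds*, LNM 1374, Springer (1989), Ch. II §1. [Kirby1989]
-/

open scoped Manifold ContDiff Topology ComplexConjugate
open Set Function Matrix

noncomputable section

namespace Literature.Topology.FourManifolds

/-- Local notation: `𝔼 n` is the model Euclidean space `EuclideanSpace ℝ (Fin n)`. -/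
local notation "𝔼 " n:arg => EuclideanSpace ℝ (Fin n)

namespace ComplexProjectiveSpace

/-! ### `ℂℙ¹` at the literal model `𝔼 2`, and the line `ℂℙ¹ ⊂ ℂℙ²` -/

/-- `ℂℙ¹` as a charted space on the literal model `EuclideanSpace ℝ (Fin 2)` (re-export of the
instance keyed at `Fin (2 * 1)`, which instance search does not unify with `Fin 2`; same device as
`ComplexProjectivePlane.instChartedSpace`). Milnor–Stasheff, *Characteristic Classes*, §14. [folklore] -/
instance instChartedSpaceOne : ChartedSpace (𝔼 2) (ComplexProjectiveSpace 1) :=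
  inferInstanceAs (ChartedSpace (𝔼 (2 * 1)) (ComplexProjectiveSpace 1))

/-- The linear inclusion `ℂ² → ℂ³`, `(v₀, v₁) ↦ (v₀, v₁, 0)`. [folklore] -/
def lineInclLinear : (Fin 2 → ℂ) →ₗ[ℂ] (Fin 3 → ℂ) where
  toFun v := ![v 0, v 1, 0]
  map_add' v w := by
    ext j; fin_cases j <;> simp
  map_smul' a v := by
    ext j; fin_cases j <;> simp

/-- Values of `lineInclLinear`. [folklore] -/
@[simp] theorem lineInclLinear_apply (v : Fin 2 → ℂ) : lineInclLinear v = ![v 0, v 1, 0] := rfl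

/-- `lineInclLinear` is injective. [folklore] -/
theorem lineInclLinear_injective : Injective lineInclLinear := by
  intro v w h
  have h0 := congr_fun h 0
  have h1 := congr_fun h 1
  simp only [lineInclLinear_apply, Matrix.cons_val_zero, Matrix.cons_val_one] at h0 h1
  ext j
  fin_cases j
  · exact h0
  · exact h1

/-- **The projective line `ℂℙ¹ ⊂ ℂℙ²`**: `[v₀ : v₁] ↦ [v₀ : v₁ : 0]`, the generator of
`H₂(ℂℙ²; ℤ)` (Milnor–Stasheff, *Characteristic Classes*, §14, Thm 14.4 ff.; Kirby, *The Topology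
of 4-Manifolds*, Ch. II §1: "`H₂(CP²; Z) = Z` with generator `CP¹ = S²`"). [cite: Kirby1989, Ch. II §1 (H₂(CP²) generated by CP¹)] -/
def lineIncl : ComplexProjectiveSpace 1 → ComplexProjectivePlane :=
  Projectivization.map lineInclLinear lineInclLinear_injective

/-- A nonzero vector of `ℂ²` goes to a nonzero vector of `ℂ³`. [folklore] -/
theorem lineInclLinear_ne_zero (v : {v : Fin 2 → ℂ // v ≠ 0}) : ![v.1 0, v.1 1, (0 : ℂ)] ≠ 0 := by
  intro h
  apply v.2
  have := lineInclLinear_injective (a₁ := v.1) (a₂ := 0) (by simpa using h)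
  exact this

/-- `lineIncl [v₀ : v₁] = [v₀ : v₁ : 0]`. [folklore] -/
theorem lineIncl_mk (v : {v : Fin 2 → ℂ // v ≠ 0}) :
    lineIncl (mk v) = mk ⟨![v.1 0, v.1 1, 0], lineInclLinear_ne_zero v⟩ := by
  simp only [lineIncl, mk, Projectivization.mk'_eq_mk, Projectivization.map_mk]
  rfl

/-- `lineIncl` is continuous (it lifts a continuous map of homogeneous coordinates through the
quotient map `mk`). [folklore] -/
theorem continuous_lineIncl : Continuous lineIncl := by
  rw [isQuotientMap_mk.continuous_iff]
  have h : lineIncl ∘ mk = mk ∘ fun v : {v : Fin 2 → ℂ // v ≠ 0} ↦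
      (⟨![v.1 0, v.1 1, 0], lineInclLinear_ne_zero v⟩ : {v : Fin 3 → ℂ // v ≠ 0}) :=
    funext lineIncl_mk
  rw [h]
  have hc : Continuous fun v : {v : Fin 2 → ℂ // v ≠ 0} ↦ lineInclLinear v.1 :=
    lineInclLinear.continuous_of_finiteDimensional.comp continuous_subtype_val
  exact continuous_mk.comp (hc.subtype_mk _)

/-- The projective line as a bundled continuous map `ℂℙ¹ → ℂℙ²`. [folklore] -/
def lineInclCM : C(ComplexProjectiveSpace 1, ComplexProjectivePlane) := ⟨lineIncl, continuous_lineIncl⟩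

/-- Values of `lineInclCM`. [folklore] -/
@[simp] theorem lineInclCM_apply (p : ComplexProjectiveSpace 1) : lineInclCM p = lineIncl p := rfl


/-- The point `[1 : w]` of `ℂℙ¹` (the inverse of the affine chart `0`, read on `ℂ`). [folklore] -/
def linePt₀ (w : ℂ) : ComplexProjectiveSpace 1 := mk ⟨![1, w], by simp⟩

/-- The point `[u : 1]` of `ℂℙ¹` (the inverse of the affine chart `1`, read on `ℂ`). [folklore] -/
def linePt₁ (u : ℂ) : ComplexProjectiveSpace 1 := mk ⟨![u, 1], by simp⟩

/-- `linePt₀` is continuous. [folklore] -/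
theorem continuous_linePt₀ : Continuous linePt₀ := by
  refine continuous_mk.comp (Continuous.subtype_mk ?_ _)
  exact continuous_pi fun j ↦ by fin_cases j <;> simp <;> fun_prop

/-- `linePt₁` is continuous. [folklore] -/
theorem continuous_linePt₁ : Continuous linePt₁ := by
  refine continuous_mk.comp (Continuous.subtype_mk ?_ _)
  exact continuous_pi fun j ↦ by fin_cases j <;> simp <;> fun_prop

/-- On the unit circle the two parametrisations agree: `[1 : w] = [w̄ : 1]` for `w w̄ = 1`. [folklore] -/
theorem linePt₀_eq_linePt₁ {w : ℂ} (hw : w * conj w = 1) : linePt₀ w = linePt₁ (conj w) := by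
  rw [linePt₀, linePt₁, mk_eq_mk_iff]
  refine ⟨w, ?_⟩
  ext j
  fin_cases j
  · simp [hw]
  · simp

/-- `lineIncl [1 : w] = [1 : w : 0]`. [folklore] -/
theorem lineIncl_linePt₀ (w : ℂ) :
    lineIncl (linePt₀ w) = mk ⟨![1, w, 0], by simp⟩ := by
  rw [linePt₀, lineIncl_mk]
  rfl

/-- `lineIncl [u : 1] = [u : 1 : 0]`. [folklore] -/
theorem lineIncl_linePt₁ (u : ℂ) :
    lineIncl (linePt₁ u) = mk ⟨![u, 1, 0], by simp⟩ := by
  rw [linePt₁, lineIncl_mk]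
  rfl

/-- `[1 : w : 0]` lies in the domain of the affine chart `0` of `ℂℙ²`. [folklore] -/
theorem coordNeZero_zero_lineIncl_linePt₀ (w : ℂ) : CoordNeZero 0 (lineIncl (linePt₀ w)) := by
  rw [lineIncl_linePt₀, coordNeZero_mk]
  simp

/-- `[u : 1 : 0]` lies in the domain of the affine chart `1` of `ℂℙ²`. [folklore] -/
theorem coordNeZero_one_lineIncl_linePt₁ (u : ℂ) : CoordNeZero 1 (lineIncl (linePt₁ u)) := by
  rw [lineIncl_linePt₁, coordNeZero_mk]
  simp

/-- For `w ≠ 0`, `[1 : w : 0]` also lies in the domain of the affine chart `1`. [folklore] -/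
theorem coordNeZero_one_lineIncl_linePt₀ {w : ℂ} (hw : w ≠ 0) : CoordNeZero 1 (lineIncl (linePt₀ w)) := by
  rw [lineIncl_linePt₀, coordNeZero_mk]
  simpa using hw

/-- The affine chart `0` of `ℂℙ²` at `[1 : w : 0]` reads `(w, 0)`. [folklore] -/
theorem affineChart_zero_lineIncl_linePt₀ (w : ℂ) :
    affineChart 0 (lineIncl (linePt₀ w)) = realCoordinates 2 ![w, 0] := by
  rw [lineIncl_linePt₀, affineChart_apply, affineCoord, Function.comp_apply, affineCoordComplex_mk]
  congr 1
  ext j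
  fin_cases j <;> simp


/-- The affine chart `k` of `ℂℙ²` as a member of its atlas (the atlas *is* the set of the three
affine charts). [folklore] -/
def chartMem (k : Fin 3) : atlas (𝔼 (2 * 2)) (ComplexProjectiveSpace 2) := ⟨affineChart k, k, rfl⟩

/-- The chart underlying `chartMem k` is `affineChart k`. [folklore] -/
@[simp] theorem coe_chartMem (k : Fin 3) : (chartMem k).1 = affineChart k := rfl

/-! ### Real coordinates on `ℂ²` in dimension `n = 2` -/

/-- The slots of `realCoordinates 2 u ∈ ℝ⁴` are `(Re u₀, Re u₁, Im u₀, Im u₁)`. [folklore] -/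
theorem realCoordinates_two_apply (u : Fin 2 → ℂ) :
    realCoordinates 2 u = WithLp.toLp 2 ![(u 0).re, (u 1).re, (u 0).im, (u 1).im] := by
  ext m
  fin_cases m <;> rfl

/-- The inverse: `(realCoordinates 2)⁻¹ x = (x₀ + i x₂, x₁ + i x₃)`. [folklore] -/
theorem realCoordinates_two_symm_apply (x : 𝔼 (2 * 2)) :
    (realCoordinates 2).symm x = ![⟨x 0, x 2⟩, ⟨x 1, x 3⟩] := by
  ext j
  all_goals fin_cases j <;> rfl

end ComplexProjectiveSpace

/-! ### Coordinates of `ℝ⁴ × ℝ` and the realified complex diagonal matrices -/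

/-- The coordinate vector in `ℝ⁵` of `(v, t) ∈ ℝ⁴ × ℝ` (`v` first, `t` last); `ℝ⁴` is the model
`EuclideanSpace ℝ (Fin (2 * 2))` of `ℂℙ²` (the key under which its charts are registered). [folklore] -/
def coord5 : (𝔼 (2 * 2) × ℝ) →ₗ[ℝ] (Fin 5 → ℝ) where
  toFun q := Fin.snoc (fun j ↦ q.1 j) q.2
  map_add' q q' := by
    ext i
    refine Fin.lastCases ?_ (fun j ↦ ?_) i
    · simp only [Fin.snoc_last, Pi.add_apply, Prod.snd_add]
    · simp only [Fin.snoc_castSucc, Pi.add_apply, Prod.fst_add, WithLp.ofLp_add]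
  map_smul' a q := by
    ext i
    refine Fin.lastCases ?_ (fun j ↦ ?_) i
    · simp only [Fin.snoc_last, Pi.smul_apply, Prod.smul_snd, RingHom.id_apply]
    · simp only [Fin.snoc_castSucc, Pi.smul_apply, Prod.smul_fst, WithLp.ofLp_smul,
        RingHom.id_apply]

/-- First four coordinates of `coord5 (v, t)`. [folklore] -/
@[simp] theorem coord5_apply_castSucc (q : 𝔼 (2 * 2) × ℝ) (j : Fin 4) : coord5 q j.castSucc = q.1 j := by
  simp only [coord5, LinearMap.coe_mk, AddHom.coe_mk, Fin.snoc_castSucc]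

/-- Last coordinate of `coord5 (v, t)`. [folklore] -/
@[simp] theorem coord5_apply_last (q : 𝔼 (2 * 2) × ℝ) : coord5 q (Fin.last 4) = q.2 := by
  simp only [coord5, LinearMap.coe_mk, AddHom.coe_mk, Fin.snoc_last]

/-- `coord5` is injective. [folklore] -/
theorem ker_coord5 : LinearMap.ker coord5 = ⊥ := by
  rw [LinearMap.ker_eq_bot']
  intro q hq
  have h1 : ∀ j : Fin 4, q.1 j = 0 := fun j ↦ by
    have := congr_fun hq j.castSucc
    rwa [coord5_apply_castSucc] at this
  have h2 : q.2 = 0 := by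
    have := congr_fun hq (Fin.last 4)
    rwa [coord5_apply_last] at this
  ext j
  · simpa using h1 j
  · exact h2

/-- **The realified complex diagonal matrix** `cmat a b`: the real `5 × 5` matrix of
`(z₀, z₁, t) ↦ (a z₀, b z₁, t)` on `ℂ² × ℝ = ℝ⁵` in the coordinates `(Re z₀, Re z₁, Im z₀, Im z₁, t)`
of `realCoordinates 2` (the shape of the clutching functions of a sum of complex line bundles,
Milnor–Stasheff, *Characteristic Classes*, §14). [folklore] -/
def cmat (a b : ℂ) : Matrix (Fin 5) (Fin 5) ℝ :=
  !![a.re, 0, -a.im, 0, 0; 0, b.re, 0, -b.im, 0; a.im, 0, a.re, 0, 0; 0, b.im, 0, b.re, 0; 0, 0, 0, 0, 1]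

/-- `cmat` is multiplicative: `cmat a b · cmat a' b' = cmat (a a') (b b')`. [folklore] -/
theorem cmat_mul (a b a' b' : ℂ) : cmat a b * cmat a' b' = cmat (a * a') (b * b') := by
  ext i j
  fin_cases i <;> fin_cases j <;>
    simp [cmat, Matrix.mul_apply, Fin.sum_univ_five, Complex.mul_re, Complex.mul_im] <;> ring

/-- `cmat 1 1 = 1`. [folklore] -/
@[simp] theorem cmat_one_one : cmat 1 1 = 1 := by
  ext i j
  fin_cases i <;> fin_cases j <;> simp [cmat]

/-- `cmat` is continuous. [folklore] -/
theorem continuous_cmat : Continuous fun p : ℂ × ℂ ↦ cmat p.1 p.2 := by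
  refine continuous_matrix fun i j ↦ ?_
  have h1 := Complex.continuous_re
  have h2 := Complex.continuous_im
  fin_cases i <;> fin_cases j <;> simp [cmat] <;> fun_prop

/-- The rotation `cmat (c - is) 1` of the `z₀`-plane written out: it is the stabilised coordinate
rotation `!![c, 0, s, 0, 0; 0, 1, 0, 0, 0; -s, 0, c, 0, 0; 0, 0, 0, 1, 0; 0, 0, 0, 0, 1]`. [folklore] -/
theorem cmat_conj_one (c s : ℝ) :
    cmat (conj ((c : ℂ) + s * Complex.I)) 1 =
      !![c, 0, s, 0, 0; 0, 1, 0, 0, 0; -s, 0, c, 0, 0; 0, 0, 0, 1, 0; 0, 0, 0, 0, 1] := by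
  ext i j
  fin_cases i <;> fin_cases j <;> simp [cmat]

/-- **`cmat a b` is the matrix of `(z₀, z₁, t) ↦ (a z₀, b z₁, t)`** in the coordinates `coord5`
after `realCoordinates 2`. [folklore] -/
theorem cmat_mulVec_coord5 (a b : ℂ) (v : 𝔼 (2 * 2)) (t : ℝ) :
    cmat a b *ᵥ coord5 (v, t) =
      coord5 (ComplexProjectiveSpace.realCoordinates 2
        ![a * (ComplexProjectiveSpace.realCoordinates 2).symm v 0,
          b * (ComplexProjectiveSpace.realCoordinates 2).symm v 1], t) := by
  rw [ComplexProjectiveSpace.realCoordinates_two_symm_apply,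
    ComplexProjectiveSpace.realCoordinates_two_apply]
  ext i
  fin_cases i <;>
    simp [cmat, coord5, Matrix.mulVec, dotProduct, Fin.sum_univ_five, Fin.snoc, Complex.mul_re,
      Complex.mul_im] <;>
    ring

/-- **The disc extension `pmat w`** of the loop `cmat (-w) w`, `|w| = 1`: right multiplication by
the quaternion `w + (1 - |w|²) j` on `ℍ = ℂ²` (realified, with the sign of the `z₀`-plane flipped),
stabilised by `1`. It is invertible for every `w ∈ ℂ` and equals `cmat (-w) w` on the unit circle:
the explicit null-homotopy of the "even" loop `w ↦ diag(-w, w)` in `GL₄(ℝ)`. [folklore] -/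
def pmat (w : ℂ) : Matrix (Fin 5) (Fin 5) ℝ :=
  !![-w.re, 1 - (w.re ^ 2 + w.im ^ 2), w.im, 0, 0;
    1 - (w.re ^ 2 + w.im ^ 2), w.re, 0, -w.im, 0;
    -w.im, 0, -w.re, -(1 - (w.re ^ 2 + w.im ^ 2)), 0;
    0, w.im, -(1 - (w.re ^ 2 + w.im ^ 2)), w.re, 0;
    0, 0, 0, 0, 1]

/-- `pmat` is continuous. [folklore] -/
theorem continuous_pmat : Continuous pmat := by
  refine continuous_matrix fun i j ↦ ?_
  have h1 := Complex.continuous_re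
  have h2 := Complex.continuous_im
  fin_cases i <;> fin_cases j <;> simp [pmat] <;> fun_prop

/-- The columns of `pmat w` are orthogonal of squared length `|w|² + (1 - |w|²)²` (resp. `1`). [folklore] -/
theorem transpose_pmat_mul_self (w : ℂ) :
    (pmat w)ᵀ * pmat w = Matrix.diagonal
      ![w.re ^ 2 + w.im ^ 2 + (1 - (w.re ^ 2 + w.im ^ 2)) ^ 2,
        w.re ^ 2 + w.im ^ 2 + (1 - (w.re ^ 2 + w.im ^ 2)) ^ 2,
        w.re ^ 2 + w.im ^ 2 + (1 - (w.re ^ 2 + w.im ^ 2)) ^ 2,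
        w.re ^ 2 + w.im ^ 2 + (1 - (w.re ^ 2 + w.im ^ 2)) ^ 2, 1] := by
  ext i j
  fin_cases i <;> fin_cases j <;>
    simp [pmat, Matrix.mul_apply, Fin.sum_univ_five, Matrix.diagonal] <;> ring

/-- `pmat w` is invertible for every `w`. [folklore] -/
theorem det_pmat_ne_zero (w : ℂ) : (pmat w).det ≠ 0 := by
  set μ := w.re ^ 2 + w.im ^ 2 + (1 - (w.re ^ 2 + w.im ^ 2)) ^ 2 with hμ
  have hpos : 0 < μ := by
    nlinarith [sq_nonneg (w.re ^ 2 + w.im ^ 2 - 1 / 2), sq_nonneg w.re, sq_nonneg w.im]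
  have h2 : (pmat w).det ^ 2 = μ ^ 4 := by
    have h := congrArg Matrix.det (transpose_pmat_mul_self w)
    rw [det_mul, det_transpose, det_diagonal] at h
    rw [sq, h]
    simp [Fin.prod_univ_five]
    ring
  intro h
  rw [h] at h2
  have : (0 : ℝ) < μ ^ 4 := by positivity
  nlinarith

/-- **On the unit circle `pmat w = cmat (-w) w`.** [folklore] -/
theorem pmat_of_sq_add_sq {w : ℂ} (hw : w.re ^ 2 + w.im ^ 2 = 1) : pmat w = cmat (-w) w := by
  ext i j
  fin_cases i <;> fin_cases j <;> simp [pmat, cmat, hw]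

/-! ### Frame matrices -/

/-- **The frame matrix** of a `5`-frame `σ` of `ℝ⁴ × ℝ`: the `5 × 5` matrix whose `c`-th column is
the coordinate vector `coord5 (σ c)`. [folklore] -/
def frameMat (σ : Fin 5 → 𝔼 (2 * 2) × ℝ) : Matrix (Fin 5) (Fin 5) ℝ :=
  Matrix.of fun r c ↦ coord5 (σ c) r

/-- Entries of the frame matrix. [folklore] -/
@[simp] theorem frameMat_apply (σ : Fin 5 → 𝔼 (2 * 2) × ℝ) (r c : Fin 5) :
    frameMat σ r c = coord5 (σ c) r := rfl

/-- The columns of the frame matrix are the coordinate vectors. [folklore] -/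
theorem col_frameMat (σ : Fin 5 → 𝔼 (2 * 2) × ℝ) : (frameMat σ).col = fun c ↦ coord5 (σ c) := rfl

/-- **A frame matrix of a linearly independent `5`-frame is invertible.** [folklore] -/
theorem det_frameMat_ne_zero {σ : Fin 5 → 𝔼 (2 * 2) × ℝ} (hσ : LinearIndependent ℝ σ) :
    (frameMat σ).det ≠ 0 := by
  have h1 : LinearIndependent ℝ (frameMat σ).col := by
    rw [col_frameMat]
    exact hσ.map' coord5 ker_coord5
  have h2 : IsUnit (frameMat σ) := linearIndependent_cols_iff_isUnit.1 h1
  rw [Matrix.isUnit_iff_isUnit_det] at h2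
  exact h2.ne_zero

/-- A matrix `M` with `coord5 (σ' c) = M · coord5 (σ c)` for all `c` satisfies `frameMat σ' = M · frameMat σ`. [folklore] -/
theorem frameMat_eq_mul {σ σ' : Fin 5 → 𝔼 (2 * 2) × ℝ} {M : Matrix (Fin 5) (Fin 5) ℝ}
    (h : ∀ c, coord5 (σ' c) = M *ᵥ coord5 (σ c)) : frameMat σ' = M * frameMat σ := by
  ext r c
  rw [frameMat_apply, h c, Matrix.mul_apply, mulVec, dotProduct]
  rfl

/-- A frame matrix depends continuously on the frame. [folklore] -/
theorem continuous_frameMat {X : Type*} [TopologicalSpace X] {σ : X → Fin 5 → 𝔼 (2 * 2) × ℝ}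
    (h1 : ∀ c, Continuous fun x ↦ (σ x c).1) (h2 : ∀ c, Continuous fun x ↦ (σ x c).2) :
    Continuous fun x ↦ frameMat (σ x) := by
  refine continuous_matrix fun r c ↦ ?_
  simp only [frameMat_apply]
  induction r using Fin.lastCases with
  | last => simp only [coord5_apply_last]; exact h2 c
  | cast j =>
    simp only [coord5_apply_castSucc]
    exact (PiLp.continuous_apply 2 _ j).comp (h1 c)

end Literature.Topology.FourManifolds
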